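import Literature.Algebra.EuclideanLattices.LLLIntegral
import HarnessLib

/-!
# Cohen's integral Gram–Schmidt table on a family with an independent PREFIX; reading off scaled Gram–Schmidt vectors

Topic `Algebra/EuclideanLattices`, a small sequel of `LLLIntegral.lean` (Cohen's integer recursion
`uRec`, `uRec_cast_eq_gsU`). Written for the machine half of the discharge of Aaronson–Arkhipov's
Main Theorem (Theory of Computing 9 (2013), Thm. 1.3; named fact
`Literature.Computability.QuantumComplexity.gpeSolvableInFBPPRel_NPRel_of_approxBosonSamplingOracle`):
there the reduction needs the exact Gram–Schmidt VECTORS (not only the coefficients) of an integer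
family `b₀, …, b_{L-1}`; appending the standard basis vectors `e₀, …, e_{m-1}` to the family and
running the SAME recursion (same machine bricks, `LLLMachineTables.lean`), the table entry
`uₖ(eₜ, bₖ) = dₖ ⟪eₜ, b*ₖ⟫` is the `t`-th coordinate of the integral vector `dₖ b*ₖ`. The appended
family is no longer linearly independent, so `uRec_cast_eq_gsU` (which asks independence of the
whole family) is re-proved under independence of a prefix only:

* `uRec_cast_eq_gsU_of_prefix` — for integer vectors whose first `L` are independent,
  `uRec b l i j = dₗ ⟪bᵢ, πₗ(bⱼ)⟫` for all `l ≤ L` and all `i, j` (same induction; `dₗ ≥ 1` for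
  `l ≤ L` from the prefix, `gramDet_comp_castLE`); `dRec_cast_eq_gramDet_of_prefix`;
* `uRec_cast_eq_gramDet_mul_inner` — at level `k < L`, column `k`: `uRec b k i k = dₖ ⟪bᵢ, b*ₖ⟫`.

Theorems only; all proved.

## References

* H. Cohen, *A Course in Computational Algebraic Number Theory*, GTM 138, Springer 1993, §2.6.3 and
  Algorithm 2.6.7 (integral Gram–Schmidt).
-/

noncomputable section

namespace Literature.Algebra.EuclideanLattices

open InnerProductSpace Finset
open scoped RealInnerProductSpace

variable {E : Type*} [NormedAddCommGroup E] [InnerProductSpace ℝ E] {N m : ℕ}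

/-- Gram determinants see only the prefix: `dₗ(f ∘ castLE) = dₗ(f)`. [folklore] -/
theorem gramDet_comp_castLE (f : Fin N → E) {L : ℕ} (hL : L ≤ N) (l : ℕ) (hl : l ≤ L) :
    gramDet (f ∘ Fin.castLE hL) l hl = gramDet f l (hl.trans hL) := rfl

/-- **Cohen's recursion is exact as soon as the vectors it projects against are independent.** For
integer vectors `b₀, …, b_{N-1}` whose first `L` are linearly independent, the integer recursion
`uRec` computes `uₗ(i, j) = dₗ ⟪bᵢ, πₗ(bⱼ)⟫` for all levels `l ≤ L` and ALL indices `i, j` (the later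
vectors need not be independent: they are only paired against the projections). Same induction as
`uRec_cast_eq_gsU`, with `dₗ ≥ 1` from the prefix. [cite: Cohen1993, Algorithm 2.6.7] -/
theorem uRec_cast_eq_gsU_of_prefix (b : Fin N → (Fin m → ℤ)) {L : ℕ} (hL : L ≤ N)
    (hli : LinearIndependent ℝ (⇑(intVecToEuclidean m).toAddMonoidHom ∘ (b ∘ Fin.castLE hL))) :
    ∀ (l : ℕ) (hl : l ≤ L) (i j : Fin N),
      (uRec b l i j : ℝ) = gsU (⇑(intVecToEuclidean m).toAddMonoidHom ∘ b) l (hl.trans hL) i j := by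
  set f := ⇑(intVecToEuclidean m).toAddMonoidHom ∘ b with hf
  have hdpos : ∀ (l : ℕ) (hl : l ≤ L), 1 ≤ gramDet f l (hl.trans hL) := by
    intro l hl
    have h := one_le_gramDet (b ∘ Fin.castLE hL) hli l hl
    exact h
  intro l
  induction l using Nat.strong_induction_on with
  | _ l ih =>
    intro hl i j
    obtain _ | l := l
    · rw [uRec_zero, cast_intGram, gsU_zero]; rfl
    have hlL : l < L := hl
    have hln : l < N := lt_of_lt_of_le hlL hL
    set Lf : Fin N := ⟨l, hln⟩ with hLf
    have ih' := ih l (Nat.lt_succ_self l) hlL.le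
    have hden : (dRec b l : ℝ) = gramDet f l hln.le := by
      obtain _ | l' := l
      · simp [dRec, gramDet_zero]
      · have h' : l' < N := by omega
        simp only [dRec, dif_pos h']
        rw [ih l' (by omega) (by omega) ⟨l', h'⟩ ⟨l', h'⟩]
        exact gsU_self f ⟨l', h'⟩
    obtain ⟨D, hD⟩ := exists_gramDet_eq_intCast b l hln.le
    have hD1 : 1 ≤ D := by
      have := hdpos l hlL.le
      rw [hD] at this; exact_mod_cast this
    obtain ⟨z, hz⟩ := exists_gsU_eq_intCast b (l + 1) hln i j
    have hnum : ((uRec b l Lf Lf * uRec b l i j - uRec b l j Lf * uRec b l i Lf : ℤ) : ℝ) = D * z := by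
      push_cast
      rw [ih' Lf Lf, ih' i j, ih' j Lf, ih' i Lf, gsU_self f Lf, gsU_self_right f j Lf,
        gsU_self_right f i Lf, ← hz, ← hD]
      have := gramDet_mul_gsU_succ f Lf i j
      rw [show gramDet f (↑Lf) (le_of_lt Lf.isLt) = gramDet f l hln.le from rfl] at this
      linarith [this]
    have hdenZ : dRec b l = D := by exact_mod_cast hden.trans hD
    have hnumZ : uRec b l Lf Lf * uRec b l i j - uRec b l j Lf * uRec b l i Lf = D * z := by
      exact_mod_cast hnum
    have e1 : uRec b (l + 1) i j =
        (uRec b l Lf Lf * uRec b l i j - uRec b l j Lf * uRec b l i Lf) / dRec b l := uRec_succ b Lf i j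
    rw [e1, hnumZ, hdenZ, Int.mul_ediv_cancel_left _ (by omega), ← hz]

/-- The `d`'s from the recursion are the Gram determinants, up to the prefix. [cite: Cohen1993, Algorithm 2.6.7] -/
theorem dRec_cast_eq_gramDet_of_prefix (b : Fin N → (Fin m → ℤ)) {L : ℕ} (hL : L ≤ N)
    (hli : LinearIndependent ℝ (⇑(intVecToEuclidean m).toAddMonoidHom ∘ (b ∘ Fin.castLE hL)))
    (l : ℕ) (hl : l ≤ L) :
    (dRec b l : ℝ) = gramDet (⇑(intVecToEuclidean m).toAddMonoidHom ∘ b) l (hl.trans hL) := by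
  obtain _ | l' := l
  · simp [dRec, gramDet_zero]
  · have h' : l' < N := by omega
    simp only [dRec, dif_pos h']
    rw [uRec_cast_eq_gsU_of_prefix b hL hli l' (by omega) ⟨l', h'⟩ ⟨l', h'⟩]
    exact gsU_self _ ⟨l', h'⟩

/-- **Reading a scaled Gram–Schmidt vector off the table.** At level `k < L` and column `k`, the
table entry in the row of any vector `bᵢ` is `dₖ ⟪bᵢ, b*ₖ⟫` — in particular, if `bᵢ` is the
`t`-th standard basis vector, it is the `t`-th coordinate of the integral vector `dₖ b*ₖ`.
[cite: Cohen1993, Algorithm 2.6.7] -/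
theorem uRec_cast_eq_gramDet_mul_inner (b : Fin N → (Fin m → ℤ)) {L : ℕ} (hL : L ≤ N)
    (hli : LinearIndependent ℝ (⇑(intVecToEuclidean m).toAddMonoidHom ∘ (b ∘ Fin.castLE hL)))
    {k : ℕ} (hk : k < L) (i : Fin N) :
    (uRec b k i ⟨k, lt_of_lt_of_le hk hL⟩ : ℝ) =
      gramDet (⇑(intVecToEuclidean m).toAddMonoidHom ∘ b) k ((le_of_lt hk).trans hL) *
        ⟪(⇑(intVecToEuclidean m).toAddMonoidHom ∘ b) i,
          gramSchmidt ℝ (⇑(intVecToEuclidean m).toAddMonoidHom ∘ b) ⟨k, lt_of_lt_of_le hk hL⟩⟫ := by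
  rw [uRec_cast_eq_gsU_of_prefix b hL hli k hk.le i ⟨k, lt_of_lt_of_le hk hL⟩, gsU]
  congr 2
  exact gsPartial_self _ ⟨k, lt_of_lt_of_le hk hL⟩

end Literature.Algebra.EuclideanLattices
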